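import Mathlib.Analysis.SpecialFunctions.Log.Base
import Mathlib.Analysis.SpecialFunctions.Pow.Real
import Mathlib.Analysis.Asymptotics.Lemmas
import Mathlib.Analysis.Complex.ExponentialBounds
import Mathlib.Combinatorics.Additive.AP.Three.Behrend
import Mathlib.Data.Nat.Choose.Bounds
import Literature.Computability.AlgebraicComplexity.MatrixMultiplicationExponent
import Literature.Computability.AlgebraicComplexity.AsymptoticSpectrum
import Literature.Computability.AlgebraicComplexity.FlatteningBound
import Literature.Computability.AlgebraicComplexity.TensorRestrictionRank
import Literature.Computability.AlgebraicComplexity.CoppersmithWinograd1990Proofs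
import HarnessLib
import Mathlib.Algebra.BigOperators.Fin
import Mathlib.Algebra.BigOperators.GroupWithZero.Finset
import Mathlib.Data.Fintype.EquivFin
import Literature.Computability.AlgebraicComplexity.BorderRankCW
import Literature.Computability.AlgebraicComplexity.SkewCoppersmithWinograd
import Literature.Computability.AlgebraicComplexity.AsymptoticRankLimit

/-!
# The laser-method bound for the skew little Coppersmith–Winograd tensor — proved
(discharge of `CGLV2022_skewCw_asymptoticRank_form` and `CGLV2022_skewCw_rank_form`)

Topic `Literature/Computability/AlgebraicComplexity`; sibling of `SkewCoppersmithWinograd.lean`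
(Conner–Gesmundo–Landsberg–Ventura 2022, §2.2, arXiv Thm. 2.5: "`T_skewcw,q` has the same block
structure as `T_cw,q`, which immediately implies Theorem (cwbndk) also holds for `T_skewcw,q`";
p. 5: "`R̃(T_skewcw,2) = 3` would imply `ω = 2`").  Made effective in three layers:

1. **The Coppersmith–Winograd "easy" bound for an ABSTRACT tensor**
   (`omega_le_logb_of_laser_restrictions`): if `T^{⊗3m} ≥ ⟨p_m⟩ ⊗ ⟨q^m,q^m,q^m⟩` for all `m ≥ 1`
   with `288 C(2m,m) p_m ≥ C(3m,m) · rothNumberNat(3 C(2m,m))`, and `R(T^{⊗N}) = O(ρ^{(1+ε)N})` for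
   every `ε > 0`, then `ω(ℂ) ≤ log_q(4ρ³/27)` — the analytic half of
   `CoppersmithWinograd1990_asymptoticRank_form_holds` (`CoppersmithWinograd1990Proofs.lean`; BCS
   Thm. 15.41 / Ex. 15.24(7), CGLV Thm. 1.1 and p. 3) verbatim with `T_cw,q` replaced by `T`:
   `a = ⌊(p_m/C_δ)^{1/(ω+δ)}⌋`, `(a q^m)^ω ≤ R(T^{⊗3m}) ≤ C_ε ρ^{3m(1+ε)}`, `C(3m,m) ≥ (27/4)^m/(3m+1)`,
   Behrend, `m → ∞`, `δ, ε → 0`.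
2. **Laser restriction for SIGNED Coppersmith–Winograd block structure**
   (`signedCw_block_diag`, `signedCw_block_support`, `signedCw_kroneckerPow_blocks`,
   `tensorRestrictsTo_precomp_mul`, `exists_restrictsTo_signedCw_kroneckerPow`): for every tensor
   `T ∈ (K^{q+1})^{⊗3}` with support `{(0,1,1),(1,0,1),(1,1,0)}` w.r.t. the blocks `{0} ∪ {1,…,q}`
   whose blocks are signed permutation matrices `T(0,x+1,y+1) = [y = σ₁ x] s₁ x`,
   `T(x+1,0,y+1) = [y = σ₂ x] s₂ x`, `T(x+1,y+1,0) = [y = σ₃ x] s₃ x` (`σᵢ` injective, `sᵢ x = ±1`),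
   `T^{⊗3m} ≥ ⟨p_m⟩ ⊗ ⟨q^m,q^m,q^m⟩` along the free balanced diagonal of
   `exists_free_balanced_diagonal` (BCS pp. 381–383 as in `CwLaserBlocks.lean`, the signs being
   absorbed into the restriction matrices).  The general laser theorem `BCS1997_thm1541`
   (`LaserMethodTheorem.lean`) wants components that are LITERALLY matrix tensors along index maps;
   the skew tensors are not block-equivalent to such (the `(1,1,0)` block stays skew under
   block-preserving base change), whence this signed variant.
3. **The skew tensor** `T_skewcw,q = skewCwTensor K u`, `q = 2u` (CGLV eq. (3)): blocks `(0,1,1)`,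
   `(1,0,1)` are identity matrices and `(1,1,0)` is the standard symplectic form, the signed
   permutation matrix of the half-swap (`skewCwTensor_succ_succ_zero` etc.); hence
   `exists_restrictsTo_skewCw_kroneckerPow` and the DISCHARGES
   `CGLV2022_skewCw_asymptoticRank_form_holds`, `CGLV2022_skewCw_rank_form_holds` (the rank form
   as the corollary via sub-multiplicativity, as `CoppersmithWinograd1990_rank_form_holds`), and
   `omega_le_two_of_skewCw_one` (`R̃(T_skewcw,2) ≤ 3 ⇒ ω ≤ 2`, unconditional).

The border-rank form `CGLV2022_skewCw_borderRank_form` (verbatim Thm. 2.5) is NOT discharged here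
(compose with `R̃ ≤ bR`, `AsymptoticRankBorderRank.lean`; left to a sequel).  Layers 1–2 were
first landed Summits-side for the route item `stmt-MatrixMultiplication-1889`
(`Summits/MatrixMultiplication/MatrixMultiplication/Theorems/AsymptoticRankCWGlueDet3Omega{Laser,Blocks}.lean`,
namespace `Summit.…`), which Literature cannot import; the statements here are their Literature
home (same proofs), flagged to the librarians as a Theorems → Literature promotion.
Everything is proved; no definitions, no named facts.

## References

* A. Conner, F. Gesmundo, J. M. Landsberg, E. Ventura, *Rank and border rank of Kronecker powers of
  tensors and Strassen's laser method*, comput. complexity 31 (2022) = arXiv:1909.04785, §2.2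
  (eq. (3), Thm. 2.5), Thm. 1.1, p. 3. [ConnerGesmundoLandsbergVentura2022]
* P. Bürgisser, M. Clausen, M. A. Shokrollahi, *Algebraic Complexity Theory* (1997), §15.6–15.8
  (Thm. 15.41 and its proof pp. 380–383), Rem. 15.44, Ex. 15.24(7). [BurgisserClausenShokrollahi1997]
* M. Bläser, *Fast Matrix Multiplication*, ToC Graduate Surveys 5 (2013), Def. 7.2, Lemma 5.4/5.8.
  [Blaser2013]
* D. Coppersmith, S. Winograd, J. Symbolic Comput. 9 (1990) 251–280, §6. [CoppersmithWinograd1990]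
-/

noncomputable section

open scoped BigOperators
open Filter Asymptotics Finset

namespace Literature.Computability.AlgebraicComplexity

universe u

/-! # Layer 1: the Coppersmith–Winograd bound for an abstract tensor -/

/-- **The Coppersmith–Winograd bound for an abstract tensor** (BCS 1997 Thm. 15.41 / Ex. 15.24(7),
CGLV 2022 Thm. 1.1 with p. 3 and §2.2, in growth form): let `T` be a tensor over `ℂ`, `q ≥ 2`,
`ρ > 0`, such that for every `m ≥ 1` the power `T^{⊗3m}` restricts to `⟨p_m⟩ ⊗ ⟨q^m,q^m,q^m⟩` for
some `p_m` with `288 C(2m,m) p_m ≥ C(3m,m) · rothNumberNat(3 C(2m,m))`, and such that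
`R(T^{⊗N}) = O(ρ^{(1+ε)N})` for every `ε > 0` (i.e. `R̃(T) ≤ ρ`). Then `ω(ℂ) ≤ log_q(4ρ³/27)`.
The proof is the restriction-only laser method of `CoppersmithWinograd1990_asymptoticRank_form_holds`,
verbatim with `T_cw,q` replaced by `T`.
[cite: BurgisserClausenShokrollahi1997, Thm. 15.41 (proof, pp. 380–383) and Ex. 15.24(7)] -/
theorem omega_le_logb_of_laser_restrictions {ι κ μ : Type} [Fintype ι] [Fintype κ] [Fintype μ]
    (T : ι → κ → μ → ℂ) (q : ℕ) (hq : 2 ≤ q) (ρ : ℝ) (hρ : 0 < ρ)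
    (hres : ∀ m : ℕ, 1 ≤ m → ∃ p : ℕ,
        (3 * m).choose m * rothNumberNat (3 * (2 * m).choose m) ≤ 288 * (2 * m).choose m * p ∧
        TensorRestrictsTo (kroneckerPow T (3 * m))
          (kroneckerTensor (unitTensor ℂ p) (matMulTensor ℂ (q ^ m) (q ^ m) (q ^ m))))
    (hyp : ∀ ε : ℝ, 0 < ε →
      (fun N : ℕ => (tensorRank (kroneckerPow T N) : ℝ)) =O[atTop]
        fun N : ℕ => ρ ^ ((1 + ε) * N)) :
    omega ℂ ≤ Real.logb q (4 * ρ ^ 3 / 27) := by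
  have hq1 : (1 : ℝ) < q := by exact_mod_cast hq
  have hq0 : (0 : ℝ) < q := by positivity
  have hlogq : 0 < Real.log q := Real.log_pos hq1
  have hω2 : 2 ≤ omega ℂ := omega_two_le ℂ
  have hω0 : 0 < omega ℂ := by linarith
  obtain ⟨L, hL⟩ : ∃ L : ℝ, L = Real.log (27 / 4) := ⟨_, rfl⟩
  have hL0 : 0 < L := hL ▸ Real.log_pos (by norm_num)
  have hL2 : L < 2 := by rw [hL, Real.log_lt_iff_lt_exp (by norm_num)]; exact exp_two_gt
  have hlog3 : Real.log 3 ≤ 2 := by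
    rw [Real.log_le_iff_le_exp (by norm_num)]; linarith [exp_two_gt]
  have hlog4 : Real.log 4 ≤ 2 := by
    rw [Real.log_le_iff_le_exp (by norm_num)]; linarith [exp_two_gt]
  -- MAIN CLAIM: for all `ε, δ > 0`, `ω (L/(ω+δ) + log q) ≤ 3 (1+ε) log ρ`
  have main : ∀ ε : ℝ, 0 < ε → ∀ δ : ℝ, 0 < δ →
      omega ℂ * (L / (omega ℂ + δ) + Real.log q) ≤ 3 * (1 + ε) * Real.log ρ := by
    intro ε hε δ hδ
    have hωδ : 0 < omega ℂ + δ := by linarith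
    -- the constant of the hypothesis
    obtain ⟨Cε, hCε, hb⟩ := bound_of_isBigO_nat_atTop (hyp ε hε)
    have hrank : ∀ N : ℕ, (tensorRank (kroneckerPow T N) : ℝ) ≤ Cε * ρ ^ ((1 + ε) * N) := by
      intro N
      have hg : ρ ^ ((1 + ε) * N) ≠ 0 := (Real.rpow_pos_of_pos hρ _).ne'
      have := hb hg
      rwa [Real.norm_of_nonneg (Nat.cast_nonneg _),
        Real.norm_of_nonneg (Real.rpow_pos_of_pos hρ _).le] at this
    -- `ω` is an exponent
    obtain ⟨Cδ, hCδ, hCδb⟩ := exists_tensorRank_matMulTensor_le_rpow ℂ hδ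
    -- the restrictions `T^{⊗3m} ≥ ⟨P m⟩ ⊗ ⟨q^m,q^m,q^m⟩`
    choose! P hPsize hPres using hres
    -- (E3) `log (P m) ≥ m L - 12 √m - log 96` for `m ≥ 1`
    have hE3 : ∀ m : ℕ, 1 ≤ m → 0 < (P m : ℝ) ∧
        (m : ℝ) * L - 12 * √(m : ℝ) - Real.log 96 ≤ Real.log (P m) := by
      intro m hm
      have hm1 : (1 : ℝ) ≤ m := by exact_mod_cast hm
      set f := (2 * m).choose m with hf
      have hf1 : 1 ≤ f := Nat.choose_pos (by omega)
      have hf0 : (0 : ℝ) < f := by exact_mod_cast hf1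
      have hf4 : (f : ℝ) ≤ 4 ^ m := by
        have : f ≤ 2 ^ (2 * m) := Nat.choose_le_two_pow _ _
        calc (f : ℝ) ≤ ((2 ^ (2 * m) : ℕ) : ℝ) := by exact_mod_cast this
          _ = 4 ^ m := by push_cast; rw [pow_mul]; norm_num
      -- Behrend
      have hB := Behrend.roth_lower_bound (N := 3 * f)
      have hsize : ((3 * m).choose m : ℝ) * rothNumberNat (3 * f) ≤ 288 * f * P m := by
        exact_mod_cast hPsize m hm
      set s : ℝ := 4 * √(Real.log ((3 * f : ℕ) : ℝ)) with hs
      have hexp : 0 < Real.exp (-s) := Real.exp_pos _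
      have hB' : ((3 * f : ℕ) : ℝ) * Real.exp (-s) ≤ rothNumberNat (3 * f) := by
        rw [hs, show -(4 * √(Real.log ((3 * f : ℕ) : ℝ))) = -4 * √(Real.log ((3 * f : ℕ) : ℝ)) by ring]
        exact hB
      have hC0 : (0 : ℝ) ≤ (3 * m).choose m := Nat.cast_nonneg _
      -- `C e^{-s} ≤ 96 P`
      have h1 : ((3 * m).choose m : ℝ) * Real.exp (-s) ≤ 96 * P m := by
        have h3f : (0 : ℝ) < ((3 * f : ℕ) : ℝ) := by positivity
        refine le_of_mul_le_mul_right ?_ h3f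
        calc ((3 * m).choose m : ℝ) * Real.exp (-s) * ((3 * f : ℕ) : ℝ)
            = ((3 * m).choose m : ℝ) * (((3 * f : ℕ) : ℝ) * Real.exp (-s)) := by ring
          _ ≤ ((3 * m).choose m : ℝ) * rothNumberNat (3 * f) := mul_le_mul_of_nonneg_left hB' hC0
          _ ≤ 288 * f * P m := hsize
          _ = 96 * P m * ((3 * f : ℕ) : ℝ) := by push_cast; ring
      have hP0 : 0 < (P m : ℝ) := by
        have : 0 < ((3 * m).choose m : ℝ) * Real.exp (-s) :=
          mul_pos (by exact_mod_cast Nat.choose_pos (by omega)) hexp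
        linarith
      refine ⟨hP0, ?_⟩
      -- `(27/4)^m e^{-s} ≤ 96 (3m+1) P`
      have h2 : ((27 : ℝ) / 4) ^ m * Real.exp (-s) ≤ 96 * (3 * m + 1) * P m := by
        calc ((27 : ℝ) / 4) ^ m * Real.exp (-s) ≤ (3 * m + 1) * ((3 * m).choose m : ℝ) * Real.exp (-s) :=
              mul_le_mul_of_nonneg_right (pow_le_mul_choose_three_mul m) hexp.le
          _ = (3 * m + 1) * (((3 * m).choose m : ℝ) * Real.exp (-s)) := by ring
          _ ≤ (3 * m + 1) * (96 * P m) := mul_le_mul_of_nonneg_left h1 (by positivity)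
          _ = 96 * (3 * m + 1) * P m := by ring
      have h3 : (m : ℝ) * L - s ≤ Real.log 96 + Real.log (3 * m + 1) + Real.log (P m) := by
        have hlhs : Real.log (((27 : ℝ) / 4) ^ m * Real.exp (-s)) = m * L - s := by
          rw [Real.log_mul (by positivity) hexp.ne', Real.log_pow, Real.log_exp, hL]; ring
        have hrhs : Real.log (96 * (3 * m + 1) * P m) =
            Real.log 96 + Real.log (3 * m + 1) + Real.log (P m) := by
          rw [Real.log_mul (by positivity) hP0.ne', Real.log_mul (by norm_num) (by positivity)]
        rw [← hlhs, ← hrhs]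
        exact Real.log_le_log (by positivity) h2
      -- `s ≤ 8 √m` and `log (3m+1) ≤ 4 √m`
      have hs8 : s ≤ 8 * √(m : ℝ) := by
        have hlog3f : Real.log ((3 * f : ℕ) : ℝ) ≤ 4 * m := by
          have : ((3 * f : ℕ) : ℝ) ≤ 3 * 4 ^ m := by push_cast; linarith
          calc Real.log ((3 * f : ℕ) : ℝ) ≤ Real.log (3 * 4 ^ m) :=
                Real.log_le_log (by positivity) this
            _ = Real.log 3 + m * Real.log 4 := by
                rw [Real.log_mul (by norm_num) (by positivity), Real.log_pow]
            _ ≤ 2 + m * 2 := by nlinarith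
            _ ≤ 4 * m := by linarith
        have : √(Real.log ((3 * f : ℕ) : ℝ)) ≤ 2 * √(m : ℝ) := by
          calc √(Real.log ((3 * f : ℕ) : ℝ)) ≤ √(4 * m) := Real.sqrt_le_sqrt hlog3f
            _ = 2 * √(m : ℝ) := by
                rw [Real.sqrt_mul (by norm_num), show (4 : ℝ) = 2 ^ 2 by norm_num,
                  Real.sqrt_sq (by norm_num)]
        rw [hs]; linarith
      have hl4 : Real.log (3 * m + 1) ≤ 4 * √(m : ℝ) := by
        calc Real.log (3 * m + 1) ≤ 2 * √(3 * m + 1) := log_le_two_mul_sqrt (by positivity)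
          _ ≤ 2 * √(4 * m) := by
              refine mul_le_mul_of_nonneg_left (Real.sqrt_le_sqrt (by linarith)) (by norm_num)
          _ = 4 * √(m : ℝ) := by
              rw [Real.sqrt_mul (by norm_num), show (4 : ℝ) = 2 ^ 2 by norm_num,
                Real.sqrt_sq (by norm_num)]; ring
      linarith
    -- the threshold beyond which `P m / Cδ ≥ 2^{ω+δ}`
    obtain ⟨m₁, hm₁⟩ := exists_nat_forall_sqrt_le 12
      (Real.log 96 + Real.log Cδ + (omega ℂ + δ) * Real.log 2) L hL0
    -- the inequality for large `m`
    refine le_of_forall_large_mul_le (c := 12 * (omega ℂ / (omega ℂ + δ)))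
      (c' := omega ℂ / (omega ℂ + δ) * (Real.log 96 + Real.log Cδ) + omega ℂ * Real.log 2 +
        Real.log Cε) ⟨max m₁ 1, fun m hm => ?_⟩
    have hm1 : 1 ≤ m := le_trans (le_max_right _ _) hm
    have hmm₁ : m₁ ≤ m := le_trans (le_max_left _ _) hm
    obtain ⟨hP0, hlogP⟩ := hE3 m hm1
    have hthr := hm₁ m hmm₁
    -- `X = (P/Cδ)^{1/(ω+δ)} ≥ 2`
    set X : ℝ := ((P m : ℝ) / Cδ) ^ (omega ℂ + δ)⁻¹ with hX
    have hPC : 0 < (P m : ℝ) / Cδ := div_pos hP0 hCδ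
    have hX0 : 0 ≤ X := Real.rpow_nonneg hPC.le _
    have hlogX : Real.log X = (Real.log (P m) - Real.log Cδ) / (omega ℂ + δ) := by
      rw [hX, Real.log_rpow hPC, Real.log_div hP0.ne' hCδ.ne']; ring
    have hX2 : 2 ≤ X := by
      have h2 : (2 : ℝ) ^ (omega ℂ + δ) ≤ (P m : ℝ) / Cδ := by
        rw [← Real.log_le_log_iff (by positivity) hPC, Real.log_rpow (by norm_num),
          Real.log_div hP0.ne' hCδ.ne']
        linarith
      calc (2 : ℝ) = ((2 : ℝ) ^ (omega ℂ + δ)) ^ (omega ℂ + δ)⁻¹ :=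
            (Real.rpow_rpow_inv (by norm_num) hωδ.ne').symm
        _ ≤ X := Real.rpow_le_rpow (by positivity) h2 (inv_nonneg.2 hωδ.le)
    -- `a = ⌊X⌋`
    set a : ℕ := ⌊X⌋₊ with ha
    have ha2 : 2 ≤ a := Nat.le_floor (by exact_mod_cast hX2)
    have haX : (a : ℝ) ≤ X := Nat.floor_le hX0
    have haX' : X / 2 ≤ a := by have := Nat.lt_floor_add_one X; linarith
    have ha0 : (0 : ℝ) < a := by exact_mod_cast (by omega : 0 < a)
    -- `R(⟨a,a,a⟩) ≤ P m`
    have hap : tensorRank (matMulTensor ℂ a a a) ≤ P m := by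
      have h1 := hCδb a (by omega)
      have h2 : (a : ℝ) ^ (omega ℂ + δ) ≤ X ^ (omega ℂ + δ) :=
        Real.rpow_le_rpow ha0.le haX hωδ.le
      have h3 : X ^ (omega ℂ + δ) = (P m : ℝ) / Cδ := by
        rw [hX]; exact Real.rpow_inv_rpow hPC.le hωδ.ne'
      have h4 : (tensorRank (matMulTensor ℂ a a a) : ℝ) ≤ P m := by
        calc (tensorRank (matMulTensor ℂ a a a) : ℝ) ≤ Cδ * (a : ℝ) ^ (omega ℂ + δ) := h1
          _ ≤ Cδ * X ^ (omega ℂ + δ) := mul_le_mul_of_nonneg_left h2 hCδ.le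
          _ = P m := by rw [h3]; field_simp
      exact_mod_cast h4
    -- (E1) `(a q^m)^ω ≤ Cε ρ^{(1+ε) 3m}`
    have hqm : (2 : ℕ) ≤ q ^ m := le_trans hq (Nat.le_self_pow (by omega) q)
    have haq : 2 ≤ a * q ^ m := le_trans hqm (Nat.le_mul_of_pos_left _ (by omega))
    have hE1 := (rpow_omega_mul_le_tensorRank_of_restrictsTo ℂ _ (hPres m hm1) hap haq).trans
      (hrank (3 * m))
    have haq0 : (0 : ℝ) < (a : ℝ) * (q : ℝ) ^ m := by positivity
    have hE1' : omega ℂ * (Real.log a + m * Real.log q) ≤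
        Real.log Cε + (1 + ε) * ((3 * m : ℕ) : ℝ) * Real.log ρ := by
      have hl := Real.log_le_log (Real.rpow_pos_of_pos (by positivity) _) hE1
      rw [Real.log_rpow (by positivity), Real.log_mul hCε.ne' (Real.rpow_pos_of_pos hρ _).ne',
        Real.log_rpow hρ] at hl
      have : Real.log (((a * q ^ m : ℕ) : ℝ)) = Real.log a + m * Real.log q := by
        push_cast
        rw [Real.log_mul ha0.ne' (by positivity), Real.log_pow]
      rw [this] at hl
      linarith
    -- (E2) `log a ≥ log X - log 2`
    have hE2 : Real.log X - Real.log 2 ≤ Real.log a := by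
      have := Real.log_le_log (by linarith) haX'
      rwa [Real.log_div (by linarith) (by norm_num)] at this
    -- combine
    have hκ : 0 < omega ℂ / (omega ℂ + δ) := div_pos hω0 hωδ
    have hcomb : omega ℂ * ((m * L - 12 * √(m : ℝ) - Real.log 96 - Real.log Cδ) / (omega ℂ + δ)
        - Real.log 2) + omega ℂ * (m * Real.log q) ≤
        Real.log Cε + 3 * (1 + ε) * Real.log ρ * m := by
      have h1 : (m * L - 12 * √(m : ℝ) - Real.log 96 - Real.log Cδ) / (omega ℂ + δ) ≤
          Real.log X := by
        rw [hlogX]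
        exact div_le_div_of_nonneg_right (by linarith) hωδ.le
      have h2 : omega ℂ * ((m * L - 12 * √(m : ℝ) - Real.log 96 - Real.log Cδ) / (omega ℂ + δ)
          - Real.log 2) ≤ omega ℂ * Real.log a :=
        mul_le_mul_of_nonneg_left (by linarith) hω0.le
      have h3 : ((3 * m : ℕ) : ℝ) = 3 * m := by push_cast; ring
      rw [h3] at hE1'
      nlinarith [hE1', h2]
    have e1 : omega ℂ * ((m * L - 12 * √(m : ℝ) - Real.log 96 - Real.log Cδ) / (omega ℂ + δ)
        - Real.log 2) + omega ℂ * (m * Real.log q) =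
        omega ℂ * (L / (omega ℂ + δ) + Real.log q) * m -
        (12 * (omega ℂ / (omega ℂ + δ)) * √(m : ℝ) +
          (omega ℂ / (omega ℂ + δ) * (Real.log 96 + Real.log Cδ) + omega ℂ * Real.log 2)) := by
      field_simp
      ring
    rw [e1] at hcomb
    linarith
  -- from the main claim: `L - δ + ω log q ≤ 3(1+ε) log ρ`
  have main' : ∀ ε : ℝ, 0 < ε → ∀ δ : ℝ, 0 < δ →
      L - δ + omega ℂ * Real.log q ≤ 3 * (1 + ε) * Real.log ρ := by
    intro ε hε δ hδ
    have h := main ε hε δ hδ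
    have hωδ : 0 < omega ℂ + δ := by linarith
    have h1 : L - δ ≤ omega ℂ * (L / (omega ℂ + δ)) := by
      rw [mul_div_assoc', le_div_iff₀ hωδ]
      nlinarith
    nlinarith
  -- `L + ω log q ≤ 3 log ρ`
  have key : L + omega ℂ * Real.log q ≤ 3 * Real.log ρ := by
    refine le_of_forall_pos_le_add fun η hη => ?_
    set ε : ℝ := η / (2 * (3 * |Real.log ρ| + 1)) with hε
    have hε0 : 0 < ε := by positivity
    have h := main' ε hε0 (η / 2) (by positivity)
    have h1 : 3 * ε * Real.log ρ ≤ η / 2 := by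
      calc 3 * ε * Real.log ρ ≤ 3 * ε * |Real.log ρ| :=
            mul_le_mul_of_nonneg_left (le_abs_self _) (by positivity)
        _ = η / 2 * (3 * |Real.log ρ| / (3 * |Real.log ρ| + 1)) := by rw [hε]; field_simp
        _ ≤ η / 2 * 1 := by
            refine mul_le_mul_of_nonneg_left ?_ (by positivity)
            rw [div_le_one (by positivity)]; linarith
        _ = η / 2 := mul_one _
    nlinarith
  -- conclusion
  have hy : 0 < 4 * ρ ^ 3 / 27 := by positivity
  rw [Real.le_logb_iff_rpow_le hq1 hy, ← Real.log_le_log_iff (Real.rpow_pos_of_pos hq0 _) hy,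
    Real.log_rpow hq0]
  have : Real.log (4 * ρ ^ 3 / 27) = 3 * Real.log ρ - L := by
    rw [hL, Real.log_div (by positivity) (by norm_num), Real.log_mul (by norm_num) (by positivity),
      Real.log_pow, Real.log_div (by norm_num) (by norm_num)]
    push_cast; ring
  rw [this]
  linarith


/-! # Layer 2: laser restriction for signed Coppersmith–Winograd block structure -/


variable {K : Type u} [CommRing K]

/-! ## One block of `T^{⊗N}` -/

section Block

/-- A product of signed indicators is the signed indicator of the conjunction:
`∏_r [u r = v r] w r = [u = v] ∏_r w r`. [folklore] -/
theorem prod_ite_eq_fun {m q : ℕ} (u v : Fin m → Fin q) (w : Fin m → K) :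
    ∏ r, (if v r = u r then w r else 0) = if u = v then ∏ r, w r else 0 := by
  classical
  by_cases h : u = v
  · subst h
    rw [if_pos rfl]
    exact Finset.prod_congr rfl fun r _ => if_pos rfl
  · rw [if_neg h]
    obtain ⟨r, hr⟩ := Function.ne_iff.1 h
    exact Finset.prod_eq_zero (Finset.mem_univ r) (if_neg (Ne.symm hr))

/-- **The diagonal blocks of `T^{⊗N}` are signed matrix multiplication tensors** (BCS p. 381:
`t^{⊗N}(x,y,z) ≃ ⊗_ρ t(x_ρ,y_ρ,z_ρ)`), for a tensor `T` with signed-permutation blocks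
`T(0,x+1,y+1) = [y = σ₁ x] s₁ x`, `T(x+1,0,y+1) = [y = σ₂ x] s₂ x`, `T(x+1,y+1,0) = [y = σ₃ x] s₃ x`:
along an ordered partition `(A,B,C)` of the positions (`|A| = |B| = |C| = m`), the indices
`a` (zero on `A`, `κ` on `C`, `ν` on `B`), `b` (zero on `B`, `σ₃ ∘ κ'` on `C`, `μ` on `A`),
`c` (zero on `C`, `σ₁ ∘ μ'` on `A`, `σ₂ ∘ ν'` on `B`) give
`∏_ρ T(a_ρ,b_ρ,c_ρ) = [κ = κ'][μ = μ'][ν = ν'] · ∏ s₁(μ) ∏ s₂(ν) ∏ s₃(κ)`.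
[cite: BurgisserClausenShokrollahi1997, Thm. 15.41 (proof, p. 381)] -/
theorem signedCw_block_diag {N q m : ℕ} (T : Fin (q + 1) → Fin (q + 1) → Fin (q + 1) → K)
    (σ₁ σ₂ σ₃ : Fin q → Fin q) (hσ₁ : Function.Injective σ₁) (hσ₂ : Function.Injective σ₂)
    (hσ₃ : Function.Injective σ₃) (s₁ s₂ s₃ : Fin q → K)
    (hT₁ : ∀ x y, T 0 x.succ y.succ = if y = σ₁ x then s₁ x else 0)
    (hT₂ : ∀ x y, T x.succ 0 y.succ = if y = σ₂ x then s₂ x else 0)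
    (hT₃ : ∀ x y, T x.succ y.succ 0 = if y = σ₃ x then s₃ x else 0)
    {A B C : Finset (Fin N)} (hAB : Disjoint A B)
    (hAC : Disjoint A C) (hBC : Disjoint B C) (hcov : A ∪ B ∪ C = Finset.univ)
    (eA : ↥A ≃ Fin m) (eB : ↥B ≃ Fin m) (eC : ↥C ≃ Fin m) (κ ν κ' μ μ' ν' : Fin m → Fin q)
    (a b c : Fin N → Fin (q + 1))
    (ha0 : ∀ ρ ∈ A, a ρ = 0) (haC : ∀ ρ (h : ρ ∈ C), a ρ = (κ (eC ⟨ρ, h⟩)).succ)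
    (haB : ∀ ρ (h : ρ ∈ B), a ρ = (ν (eB ⟨ρ, h⟩)).succ)
    (hb0 : ∀ ρ ∈ B, b ρ = 0) (hbC : ∀ ρ (h : ρ ∈ C), b ρ = (σ₃ (κ' (eC ⟨ρ, h⟩))).succ)
    (hbA : ∀ ρ (h : ρ ∈ A), b ρ = (μ (eA ⟨ρ, h⟩)).succ)
    (hc0 : ∀ ρ ∈ C, c ρ = 0) (hcA : ∀ ρ (h : ρ ∈ A), c ρ = (σ₁ (μ' (eA ⟨ρ, h⟩))).succ)
    (hcB : ∀ ρ (h : ρ ∈ B), c ρ = (σ₂ (ν' (eB ⟨ρ, h⟩))).succ) :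
    ∏ ρ, T (a ρ) (b ρ) (c ρ) =
      if κ = κ' ∧ μ = μ' ∧ ν = ν' then (∏ r, s₁ (μ r)) * (∏ r, s₂ (ν r)) * ∏ r, s₃ (κ r)
      else 0 := by
  classical
  have hAuBC : Disjoint (A ∪ B) C := Finset.disjoint_union_left.2 ⟨hAC, hBC⟩
  rw [← hcov, Finset.prod_union hAuBC, Finset.prod_union hAB]
  -- the three partial products
  have hA : ∏ ρ ∈ A, T (a ρ) (b ρ) (c ρ) = ∏ r, if μ' r = μ r then s₁ (μ r) else 0 := by
    rw [← Finset.prod_coe_sort A]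
    refine Fintype.prod_equiv eA _ _ fun i => ?_
    rw [ha0 _ i.2, hbA _ i.2, hcA _ i.2, hT₁]
    simp only [Subtype.coe_eta]
    by_cases h : μ' (eA i) = μ (eA i)
    · rw [if_pos h, if_pos (congrArg σ₁ h)]
    · rw [if_neg h, if_neg fun h' => h (hσ₁ h')]
  have hB : ∏ ρ ∈ B, T (a ρ) (b ρ) (c ρ) = ∏ r, if ν' r = ν r then s₂ (ν r) else 0 := by
    rw [← Finset.prod_coe_sort B]
    refine Fintype.prod_equiv eB _ _ fun i => ?_
    rw [hb0 _ i.2, haB _ i.2, hcB _ i.2, hT₂]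
    simp only [Subtype.coe_eta]
    by_cases h : ν' (eB i) = ν (eB i)
    · rw [if_pos h, if_pos (congrArg σ₂ h)]
    · rw [if_neg h, if_neg fun h' => h (hσ₂ h')]
  have hC : ∏ ρ ∈ C, T (a ρ) (b ρ) (c ρ) = ∏ r, if κ' r = κ r then s₃ (κ r) else 0 := by
    rw [← Finset.prod_coe_sort C]
    refine Fintype.prod_equiv eC _ _ fun i => ?_
    rw [hc0 _ i.2, haC _ i.2, hbC _ i.2, hT₃]
    simp only [Subtype.coe_eta]
    by_cases h : κ' (eC i) = κ (eC i)
    · rw [if_pos h, if_pos (congrArg σ₃ h)]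
    · rw [if_neg h, if_neg fun h' => h (hσ₃ h')]
  rw [hA, hB, hC, prod_ite_eq_fun μ μ' (fun r => s₁ (μ r)), prod_ite_eq_fun ν ν' (fun r => s₂ (ν r)),
    prod_ite_eq_fun κ κ' (fun r => s₃ (κ r))]
  by_cases h : κ = κ' ∧ μ = μ' ∧ ν = ν'
  · rw [if_pos h, if_pos h.1, if_pos h.2.1, if_pos h.2.2]
  · rw [if_neg h]
    by_cases hκ : κ = κ'
    · by_cases hμ : μ = μ'
      · have hν : ν ≠ ν' := fun hν => h ⟨hκ, hμ, hν⟩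
        rw [if_neg hν, mul_zero, zero_mul]
      · rw [if_neg hμ, zero_mul, zero_mul]
    · rw [if_neg hκ, mul_zero]

/-- **Off-diagonal blocks vanish unless the zero sets form a partition** (BCS p. 372/381:
`supp_{D^{⊗N}} t^{⊗N} = (supp_D t)^N` with `supp_D t = {(0,1,1),(1,0,1),(1,1,0)}`): if every
non-zero entry of `T` has exactly one zero coordinate and `∏_ρ T(a_ρ,b_ρ,c_ρ) ≠ 0`, then the zero
sets of `a, b, c` are pairwise disjoint and cover all positions.
[cite: BurgisserClausenShokrollahi1997, Thm. 15.41 (proof, p. 381)] -/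
theorem signedCw_block_support {N q : ℕ} (T : Fin (q + 1) → Fin (q + 1) → Fin (q + 1) → K)
    (hsupp : ∀ i j k, T i j k ≠ 0 →
      (i = 0 ∧ j ≠ 0 ∧ k ≠ 0) ∨ (j = 0 ∧ i ≠ 0 ∧ k ≠ 0) ∨ (k = 0 ∧ i ≠ 0 ∧ j ≠ 0))
    {A B C : Finset (Fin N)} (a b c : Fin N → Fin (q + 1))
    (ha : ∀ ρ, a ρ = 0 ↔ ρ ∈ A) (hb : ∀ ρ, b ρ = 0 ↔ ρ ∈ B) (hc : ∀ ρ, c ρ = 0 ↔ ρ ∈ C)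
    (hne : ∏ ρ, T (a ρ) (b ρ) (c ρ) ≠ 0) :
    Disjoint A B ∧ Disjoint A C ∧ Disjoint B C ∧ A ∪ B ∪ C = Finset.univ := by
  classical
  have hρ : ∀ ρ, T (a ρ) (b ρ) (c ρ) ≠ 0 := fun ρ h =>
    hne (Finset.prod_eq_zero (Finset.mem_univ ρ) h)
  have hpat := fun ρ => hsupp _ _ _ (hρ ρ)
  refine ⟨Finset.disjoint_left.2 fun ρ hA hB => ?_, Finset.disjoint_left.2 fun ρ hA hC => ?_,
    Finset.disjoint_left.2 fun ρ hB hC => ?_, ?_⟩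
  · rcases hpat ρ with ⟨-, h2, -⟩ | ⟨-, h1, -⟩ | ⟨-, h1, -⟩
    exacts [h2 ((hb ρ).2 hB), h1 ((ha ρ).2 hA), h1 ((ha ρ).2 hA)]
  · rcases hpat ρ with ⟨-, -, h3⟩ | ⟨-, h1, -⟩ | ⟨-, h1, -⟩
    exacts [h3 ((hc ρ).2 hC), h1 ((ha ρ).2 hA), h1 ((ha ρ).2 hA)]
  · rcases hpat ρ with ⟨-, h2, -⟩ | ⟨-, -, h3⟩ | ⟨-, -, h2⟩
    exacts [h2 ((hb ρ).2 hB), h3 ((hc ρ).2 hC), h2 ((hb ρ).2 hB)]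
  · refine Finset.eq_univ_of_forall fun ρ => ?_
    simp only [Finset.mem_union]
    rcases hpat ρ with ⟨h1, -, -⟩ | ⟨h2, -, -⟩ | ⟨h3, -, -⟩
    · exact Or.inl (Or.inl ((ha ρ).1 h1))
    · exact Or.inl (Or.inr ((hb ρ).1 h2))
    · exact Or.inr ((hc ρ).1 h3)

end Block

/-! ## The Kronecker power along a free diagonal -/

section Main

/-- A product of factors each squaring to one squares to one: `∏ w r * ∏ w r = 1` if
`w r * w r = 1` for all `r`. [folklore] -/
theorem prod_mul_prod_eq_one {m : ℕ} (w : Fin m → K) (hw : ∀ r, w r * w r = 1) :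
    (∏ r, w r) * ∏ r, w r = 1 := by
  rw [← Finset.prod_mul_distrib]
  exact Finset.prod_eq_one fun r _ => hw r

/-- **Laser method, combinatorial-restriction form, for signed Coppersmith–Winograd block
structure** (BCS 1997, proof of Thm. 15.41, pp. 381–383, run for a tensor `T` whose three blocks
are signed permutation matrices `[y = σᵢ x] sᵢ x`, `sᵢ x = ±1` — "the same block structure as
`T_cw,q`", CGLV 2022 §2.2): for a free diagonal `Δ` of balanced ordered partitions `(A,B,C)` of the
`N` positions there are index maps `F, G, H` and signs `φ, ψ` with
`⟨|Δ|⟩ ⊗ ⟨q^m,q^m,q^m⟩ = φ(x) ψ(y) · T^{⊗N}(F x, G y, H z)`, i.e. zeroing out, relabelling and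
re-signing coordinates of `T^{⊗N}` leaves exactly `|Δ|` independent matrix products.
[cite: BurgisserClausenShokrollahi1997, Thm. 15.41 (proof, p. 381)] -/
theorem signedCw_kroneckerPow_blocks (q m N : ℕ) (T : Fin (q + 1) → Fin (q + 1) → Fin (q + 1) → K)
    (σ₁ σ₂ σ₃ : Fin q → Fin q) (hσ₁ : Function.Injective σ₁) (hσ₂ : Function.Injective σ₂)
    (hσ₃ : Function.Injective σ₃) (s₁ s₂ s₃ : Fin q → K)
    (hs₁ : ∀ x, s₁ x * s₁ x = 1) (hs₂ : ∀ x, s₂ x * s₂ x = 1) (hs₃ : ∀ x, s₃ x * s₃ x = 1)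
    (hT₁ : ∀ x y, T 0 x.succ y.succ = if y = σ₁ x then s₁ x else 0)
    (hT₂ : ∀ x y, T x.succ 0 y.succ = if y = σ₂ x then s₂ x else 0)
    (hT₃ : ∀ x y, T x.succ y.succ 0 = if y = σ₃ x then s₃ x else 0)
    (hsupp : ∀ i j k, T i j k ≠ 0 →
      (i = 0 ∧ j ≠ 0 ∧ k ≠ 0) ∨ (j = 0 ∧ i ≠ 0 ∧ k ≠ 0) ∨ (k = 0 ∧ i ≠ 0 ∧ j ≠ 0))
    (Δ : Finset (Finset (Fin N) × Finset (Fin N) × Finset (Fin N)))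
    (hcard : ∀ δ ∈ Δ, δ.1.card = m ∧ δ.2.1.card = m ∧ δ.2.2.card = m)
    (hpart : ∀ δ ∈ Δ, Disjoint δ.1 δ.2.1 ∧ Disjoint δ.1 δ.2.2 ∧ Disjoint δ.2.1 δ.2.2 ∧
      δ.1 ∪ δ.2.1 ∪ δ.2.2 = Finset.univ)
    (hfree : ∀ δ ∈ Δ, ∀ δ' ∈ Δ, ∀ δ'' ∈ Δ, Disjoint δ.1 δ'.2.1 → Disjoint δ.1 δ''.2.2 →
      Disjoint δ'.2.1 δ''.2.2 → δ.1 ∪ δ'.2.1 ∪ δ''.2.2 = Finset.univ → δ = δ' ∧ δ' = δ'') :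
    ∃ (F G H : Fin Δ.card × (Fin (q ^ m) × Fin (q ^ m)) → (Fin N → Fin (q + 1)))
      (φ ψ : Fin Δ.card × (Fin (q ^ m) × Fin (q ^ m)) → K),
      kroneckerTensor (unitTensor K Δ.card) (matMulTensor K (q ^ m) (q ^ m) (q ^ m)) =
        fun x y z => φ x * ψ y * kroneckerPow T N (F x) (G y) (H z) := by
  classical
  -- enumerate `Δ` and its blocks
  let δ : Fin Δ.card → Finset (Fin N) × Finset (Fin N) × Finset (Fin N) :=
    fun s => (Δ.equivFin.symm s).1
  have hδmem : ∀ s, δ s ∈ Δ := fun s => (Δ.equivFin.symm s).2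
  have hδinj : Function.Injective δ :=
    Subtype.val_injective.comp Δ.equivFin.symm.injective
  let eA : ∀ s, ↥(δ s).1 ≃ Fin m := fun s => Finset.equivFinOfCardEq (hcard _ (hδmem s)).1
  let eB : ∀ s, ↥(δ s).2.1 ≃ Fin m := fun s => Finset.equivFinOfCardEq (hcard _ (hδmem s)).2.1
  let eC : ∀ s, ↥(δ s).2.2 ≃ Fin m := fun s => Finset.equivFinOfCardEq (hcard _ (hδmem s)).2.2
  -- `Fin (q^m)` as functions
  let f : Fin (q ^ m) → Fin m → Fin q := fun κ => finFunctionFinEquiv.symm κ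
  have hf : ∀ κ κ' : Fin (q ^ m), f κ = f κ' ↔ κ = κ' := fun κ κ' =>
    finFunctionFinEquiv.symm.injective.eq_iff
  -- the index maps
  let F : Fin Δ.card × (Fin (q ^ m) × Fin (q ^ m)) → Fin N → Fin (q + 1) := fun x ρ =>
    if h : ρ ∈ (δ x.1).2.2 then (f x.2.1 (eC x.1 ⟨ρ, h⟩)).succ
    else if h' : ρ ∈ (δ x.1).2.1 then (f x.2.2 (eB x.1 ⟨ρ, h'⟩)).succ else 0
  let G : Fin Δ.card × (Fin (q ^ m) × Fin (q ^ m)) → Fin N → Fin (q + 1) := fun y ρ =>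
    if h : ρ ∈ (δ y.1).2.2 then (σ₃ (f y.2.1 (eC y.1 ⟨ρ, h⟩))).succ
    else if h' : ρ ∈ (δ y.1).1 then (f y.2.2 (eA y.1 ⟨ρ, h'⟩)).succ else 0
  let H : Fin Δ.card × (Fin (q ^ m) × Fin (q ^ m)) → Fin N → Fin (q + 1) := fun z ρ =>
    if h : ρ ∈ (δ z.1).1 then (σ₁ (f z.2.1 (eA z.1 ⟨ρ, h⟩))).succ
    else if h' : ρ ∈ (δ z.1).2.1 then (σ₂ (f z.2.2 (eB z.1 ⟨ρ, h'⟩))).succ else 0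
  -- the signs
  let φ : Fin Δ.card × (Fin (q ^ m) × Fin (q ^ m)) → K := fun x =>
    (∏ r, s₂ (f x.2.2 r)) * ∏ r, s₃ (f x.2.1 r)
  let ψ : Fin Δ.card × (Fin (q ^ m) × Fin (q ^ m)) → K := fun y => ∏ r, s₁ (f y.2.2 r)
  -- zero sets of the embedded indices
  have hF0 : ∀ x ρ, F x ρ = 0 ↔ ρ ∈ (δ x.1).1 := by
    intro x ρ
    obtain ⟨hab, hac, hbc, hcov⟩ := hpart _ (hδmem x.1)
    simp only [F]
    constructor
    · intro h
      by_cases h1 : ρ ∈ (δ x.1).2.2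
      · rw [dif_pos h1] at h; exact absurd h (Fin.succ_ne_zero _)
      · by_cases h2 : ρ ∈ (δ x.1).2.1
        · rw [dif_neg h1, dif_pos h2] at h; exact absurd h (Fin.succ_ne_zero _)
        · have := Finset.eq_univ_iff_forall.1 hcov ρ; simp only [Finset.mem_union] at this; tauto
    · intro h
      rw [dif_neg (Finset.disjoint_left.1 hac h), dif_neg (Finset.disjoint_left.1 hab h)]
  have hG0 : ∀ y ρ, G y ρ = 0 ↔ ρ ∈ (δ y.1).2.1 := by
    intro y ρ
    obtain ⟨hab, hac, hbc, hcov⟩ := hpart _ (hδmem y.1)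
    simp only [G]
    constructor
    · intro h
      by_cases h1 : ρ ∈ (δ y.1).2.2
      · rw [dif_pos h1] at h; exact absurd h (Fin.succ_ne_zero _)
      · by_cases h2 : ρ ∈ (δ y.1).1
        · rw [dif_neg h1, dif_pos h2] at h; exact absurd h (Fin.succ_ne_zero _)
        · have := Finset.eq_univ_iff_forall.1 hcov ρ; simp only [Finset.mem_union] at this; tauto
    · intro h
      rw [dif_neg (Finset.disjoint_left.1 hbc h), dif_neg (Finset.disjoint_right.1 hab h)]
  have hH0 : ∀ z ρ, H z ρ = 0 ↔ ρ ∈ (δ z.1).2.2 := by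
    intro z ρ
    obtain ⟨hab, hac, hbc, hcov⟩ := hpart _ (hδmem z.1)
    simp only [H]
    constructor
    · intro h
      by_cases h1 : ρ ∈ (δ z.1).1
      · rw [dif_pos h1] at h; exact absurd h (Fin.succ_ne_zero _)
      · by_cases h2 : ρ ∈ (δ z.1).2.1
        · rw [dif_neg h1, dif_pos h2] at h; exact absurd h (Fin.succ_ne_zero _)
        · have := Finset.eq_univ_iff_forall.1 hcov ρ; simp only [Finset.mem_union] at this; tauto
    · intro h
      rw [dif_neg (Finset.disjoint_right.1 hac h), dif_neg (Finset.disjoint_right.1 hbc h)]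
  -- signs square to one
  have hφ : ∀ x, φ x * φ x = 1 := by
    intro x
    have h2 := prod_mul_prod_eq_one _ (fun r => hs₂ (f x.2.2 r))
    have h3 := prod_mul_prod_eq_one _ (fun r => hs₃ (f x.2.1 r))
    simp only [φ]
    linear_combination ((∏ r, s₃ (f x.2.1 r)) * ∏ r, s₃ (f x.2.1 r)) * h2 + h3
  have hψ : ∀ y, ψ y * ψ y = 1 := fun y => prod_mul_prod_eq_one _ (fun r => hs₁ _)
  refine ⟨F, G, H, φ, ψ, ?_⟩
  funext x y z
  obtain ⟨s, κ, ν⟩ := x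
  obtain ⟨s', κ', μ⟩ := y
  obtain ⟨s'', μ', ν'⟩ := z
  rw [kroneckerTensor_apply, kroneckerPow_apply, unitTensor_apply]
  by_cases hs : s = s' ∧ s' = s''
  · -- a diagonal block: the matrix multiplication tensor, up to the sign `φ x ψ y`
    obtain ⟨rfl, rfl⟩ := hs
    rw [if_pos ⟨rfl, rfl⟩, one_mul]
    obtain ⟨hab, hac, hbc, hcov⟩ := hpart _ (hδmem s)
    have key := signedCw_block_diag T σ₁ σ₂ σ₃ hσ₁ hσ₂ hσ₃ s₁ s₂ s₃ hT₁ hT₂ hT₃ hab hac hbc hcov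
      (eA s) (eB s) (eC s) (f κ) (f ν) (f κ') (f μ) (f μ') (f ν')
      (F (s, κ, ν)) (G (s, κ', μ)) (H (s, μ', ν')) (fun ρ h => (hF0 _ ρ).2 h)
      (fun ρ h => by simp only [F]; rw [dif_pos h])
      (fun ρ h => by simp only [F]; rw [dif_neg (Finset.disjoint_left.1 hbc h), dif_pos h])
      (fun ρ h => (hG0 _ ρ).2 h)
      (fun ρ h => by simp only [G]; rw [dif_pos h])
      (fun ρ h => by simp only [G]; rw [dif_neg (Finset.disjoint_left.1 hac h), dif_pos h])
      (fun ρ h => (hH0 _ ρ).2 h)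
      (fun ρ h => by simp only [H]; rw [dif_pos h])
      (fun ρ h => by simp only [H]; rw [dif_neg (Finset.disjoint_right.1 hab h), dif_pos h])
    rw [key]
    simp only [matMulTensor]
    by_cases h : κ = κ' ∧ μ = μ' ∧ ν = ν'
    · obtain ⟨rfl, rfl, rfl⟩ := h
      rw [if_pos ⟨rfl, rfl, rfl⟩, if_pos ⟨rfl, rfl, rfl⟩]
      have e : φ (s, κ, ν) * ψ (s, κ, μ) *
          ((∏ r, s₁ (f μ r)) * (∏ r, s₂ (f ν r)) * ∏ r, s₃ (f κ r)) =
          (φ (s, κ, ν) * φ (s, κ, ν)) * (ψ (s, κ, μ) * ψ (s, κ, μ)) := by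
        simp only [φ, ψ]; ring
      rw [e, hφ, hψ, one_mul]
    · rw [if_neg h, if_neg fun h' => h ⟨(hf _ _).1 h'.1, (hf _ _).1 h'.2.1, (hf _ _).1 h'.2.2⟩,
        mul_zero]
  · -- an off-diagonal block vanishes, by freeness of `Δ`
    rw [if_neg hs, zero_mul]
    by_cases hzero : kroneckerPow T N (F (s, κ, ν)) (G (s', κ', μ)) (H (s'', μ', ν')) = 0
    · rw [kroneckerPow_apply] at hzero
      rw [hzero, mul_zero]
    exfalso
    rw [kroneckerPow_apply] at hzero
    obtain ⟨h1, h2, h3, h4⟩ := signedCw_block_support T hsupp (F (s, κ, ν)) (G (s', κ', μ))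
      (H (s'', μ', ν')) (hF0 _) (hG0 _) (hH0 _) hzero
    obtain ⟨e1, e2⟩ := hfree _ (hδmem s) _ (hδmem s') _ (hδmem s'') h1 h2 h3 h4
    exact hs ⟨hδinj e1, hδinj e2⟩

/-- **Weighted relabelling along index maps is a restriction**: for index maps `f, g, h` and
weights `φ, ψ`, `t ≥ (φ(a) ψ(b) · t (f a) (g b) (h c))_{a,b,c}` (the matrices `A = diag(φ) f^*`,
`B = diag(ψ) g^*`, `C = h^*`; Bläser 2013, Def. 7.2 / Lemma 5.4). [cite: Blaser2013, Def. 7.2] -/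
theorem tensorRestrictsTo_precomp_mul {ι κ μ ι' κ' μ' : Type*} [Fintype ι] [Fintype κ] [Fintype μ]
    [DecidableEq ι] [DecidableEq κ] [DecidableEq μ] (t : ι → κ → μ → K) (f : ι' → ι) (g : κ' → κ)
    (h : μ' → μ) (φ : ι' → K) (ψ : κ' → K) :
    TensorRestrictsTo t (fun a b c => φ a * ψ b * t (f a) (g b) (h c)) := by
  refine ⟨fun a' a => if f a' = a then φ a' else 0, fun b' b => if g b' = b then ψ b' else 0,
    fun c' c => if h c' = c then 1 else 0, fun a' b' c' => ?_⟩
  rw [Finset.sum_eq_single (f a') (fun a _ ha => by simp [Ne.symm ha]) (by simp),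
    Finset.sum_eq_single (g b') (fun b _ hb => by simp [Ne.symm hb]) (by simp),
    Finset.sum_eq_single (h c') (fun c _ hc => by simp [Ne.symm hc]) (by simp)]
  simp

/-- **`T^{⊗3m} ≥ ⟨p_m⟩ ⊗ ⟨q^m, q^m, q^m⟩` with `288 C(2m,m) p_m ≥ C(3m,m) · rothNumberNat(3 C(2m,m))`**
for every tensor `T` with signed Coppersmith–Winograd block structure (BCS p. 381:
`⊕_{Δ} t^{⊗N}(x,y,z) ≤ t^{⊗N}`, `|Δ| ≥ C min binom`, each component `≃ ⟨q^{N/3},q^{N/3},q^{N/3}⟩`),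
as a genuine restriction: the free balanced diagonal of `exists_free_balanced_diagonal` and
`signedCw_kroneckerPow_blocks`. [cite: BurgisserClausenShokrollahi1997, Thm. 15.41 (proof, p. 381)] -/
theorem exists_restrictsTo_signedCw_kroneckerPow (q m : ℕ) (hm : 1 ≤ m)
    (T : Fin (q + 1) → Fin (q + 1) → Fin (q + 1) → K)
    (σ₁ σ₂ σ₃ : Fin q → Fin q) (hσ₁ : Function.Injective σ₁) (hσ₂ : Function.Injective σ₂)
    (hσ₃ : Function.Injective σ₃) (s₁ s₂ s₃ : Fin q → K)
    (hs₁ : ∀ x, s₁ x * s₁ x = 1) (hs₂ : ∀ x, s₂ x * s₂ x = 1) (hs₃ : ∀ x, s₃ x * s₃ x = 1)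
    (hT₁ : ∀ x y, T 0 x.succ y.succ = if y = σ₁ x then s₁ x else 0)
    (hT₂ : ∀ x y, T x.succ 0 y.succ = if y = σ₂ x then s₂ x else 0)
    (hT₃ : ∀ x y, T x.succ y.succ 0 = if y = σ₃ x then s₃ x else 0)
    (hsupp : ∀ i j k, T i j k ≠ 0 →
      (i = 0 ∧ j ≠ 0 ∧ k ≠ 0) ∨ (j = 0 ∧ i ≠ 0 ∧ k ≠ 0) ∨ (k = 0 ∧ i ≠ 0 ∧ j ≠ 0)) :
    ∃ p : ℕ, (3 * m).choose m * rothNumberNat (3 * (2 * m).choose m) ≤ 288 * (2 * m).choose m * p ∧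
      TensorRestrictsTo (kroneckerPow T (3 * m))
        (kroneckerTensor (unitTensor K p) (matMulTensor K (q ^ m) (q ^ m) (q ^ m))) := by
  classical
  obtain ⟨Δ, hcard, hpart, hfree, hsize⟩ := exists_free_balanced_diagonal m hm
  obtain ⟨F, G, H, φ, ψ, hFGH⟩ := signedCw_kroneckerPow_blocks q m (3 * m) T σ₁ σ₂ σ₃ hσ₁ hσ₂ hσ₃
    s₁ s₂ s₃ hs₁ hs₂ hs₃ hT₁ hT₂ hT₃ hsupp Δ hcard hpart hfree
  refine ⟨Δ.card, hsize, ?_⟩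
  rw [hFGH]
  exact tensorRestrictsTo_precomp_mul _ F G H φ ψ

end Main


/-! # Layer 3: the skew little Coppersmith–Winograd tensor -/


/-! ## Entries of `T_skewcw,q` on the blocks -/

section SkewEntries

variable (R : Type u) [CommRing R]

/-- `T_skewcw,q(0, x+1, y+1) = [x = y]`: the block `(0,1,1)` of `T_skewcw,q` is the identity
matrix (CGLV eq. (3)). [cite: ConnerGesmundoLandsbergVentura2022, eq. (3)] -/
theorem skewCwTensor_zero_succ_succ (u : ℕ) (x y : Fin (2 * u)) :
    skewCwTensor R u 0 x.succ y.succ = if y = x then 1 else 0 := by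
  simp only [skewCwTensor, Fin.succ_inj, Fin.succ_ne_zero, ne_eq, not_false_eq_true, and_true,
    true_and, false_and, or_false, if_false]
  by_cases h : x = y
  · rw [if_pos h, if_pos h.symm]
  · rw [if_neg h, if_neg (Ne.symm h)]

/-- `T_skewcw,q(x+1, 0, y+1) = [x = y]` (block `(1,0,1)`, CGLV eq. (3)).
[cite: ConnerGesmundoLandsbergVentura2022, eq. (3)] -/
theorem skewCwTensor_succ_zero_succ (u : ℕ) (x y : Fin (2 * u)) :
    skewCwTensor R u x.succ 0 y.succ = if y = x then 1 else 0 := by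
  simp only [skewCwTensor, Fin.succ_inj, Fin.succ_ne_zero, ne_eq, not_false_eq_true, and_true,
    true_and, false_and, false_or, and_false, if_false, (Fin.succ_ne_zero y).symm]
  by_cases h : x = y
  · rw [if_pos h, if_pos h.symm]
  · rw [if_neg h, if_neg (Ne.symm h)]

/-- `T_skewcw,q(x+1, y+1, 0) = [y = σ x] s(x)` with `σ` the swap of the two halves
`{1,…,u} ↔ {u+1,…,2u}` and `s = +1` on the first half, `-1` on the second (the block `(1,1,0)` is
the standard symplectic form, CGLV eq. (3)). [cite: ConnerGesmundoLandsbergVentura2022, eq. (3)] -/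
theorem skewCwTensor_succ_succ_zero (u : ℕ) (x y : Fin (2 * u)) :
    skewCwTensor R u x.succ y.succ 0 =
      if (y : ℕ) = (if (x : ℕ) < u then (x : ℕ) + u else (x : ℕ) - u) then
        (if (x : ℕ) < u then (1 : R) else -1) else 0 := by
  have hx := x.2
  simp only [skewCwTensor, Fin.succ_ne_zero, and_false, false_and, or_self, if_false, true_and,
    Fin.val_succ]
  by_cases hxu : (x : ℕ) < u
  · simp only [hxu, if_true]
    by_cases h : (y : ℕ) = (x : ℕ) + u
    · rw [if_pos ⟨by omega, by omega, by omega⟩, if_pos h]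
    · rw [if_neg (by omega), if_neg (by omega), if_neg h]
  · simp only [hxu, if_false]
    by_cases h : (y : ℕ) = (x : ℕ) - u
    · rw [if_neg (by omega), if_pos ⟨by omega, by omega, by omega⟩, if_pos h]
    · rw [if_neg (by omega), if_neg (by omega), if_neg h]

/-- The support of `T_skewcw,q` with respect to the blocks `{0} ∪ {1,…,q}` is
`{(0,1,1),(1,0,1),(1,1,0)}` ("the same block structure as `T_cw,q`", CGLV §2.2).
[cite: ConnerGesmundoLandsbergVentura2022, §2.2] -/
theorem skewCwTensor_ne_zero_pattern (u : ℕ) {i j k : Fin (2 * u + 1)}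
    (h : skewCwTensor R u i j k ≠ 0) :
    (i = 0 ∧ j ≠ 0 ∧ k ≠ 0) ∨ (j = 0 ∧ i ≠ 0 ∧ k ≠ 0) ∨ (k = 0 ∧ i ≠ 0 ∧ j ≠ 0) := by
  simp only [skewCwTensor] at h
  split_ifs at h with h1 h2 h3
  · rcases h1 with ⟨hi, hjk, hj⟩ | ⟨hj, hik, hi⟩
    · exact Or.inl ⟨hi, hj, hjk ▸ hj⟩
    · exact Or.inr (Or.inl ⟨hj, hi, hik ▸ hi⟩)
  · refine Or.inr (Or.inr ⟨h2.1, ?_, ?_⟩)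
    · intro hi; rw [hi, Fin.val_zero] at h2; omega
    · intro hj; rw [hj, Fin.val_zero] at h2; omega
  · refine Or.inr (Or.inr ⟨h3.1, ?_, ?_⟩)
    · intro hi; rw [hi, Fin.val_zero] at h3; omega
    · intro hj; rw [hj, Fin.val_zero] at h3; omega
  · exact absurd rfl h

/-- `T_skewcw,q` has the entry `1` at `(0, q, q)` for `u ≥ 1`, so it is non-zero.
[cite: ConnerGesmundoLandsbergVentura2022, eq. (3)] -/
theorem skewCwTensor_ne_zero (u : ℕ) (hu : 1 ≤ u) [Nontrivial R] : skewCwTensor R u ≠ 0 := by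
  intro h0
  have hj : (Fin.last (2 * u) : Fin (2 * u + 1)) ≠ 0 := by
    intro h'
    have := congrArg Fin.val h'
    simp only [Fin.val_last, Fin.val_zero] at this
    omega
  have h1 : skewCwTensor R u 0 (Fin.last (2 * u)) (Fin.last (2 * u)) = 1 := by
    simp [skewCwTensor, hj]
  rw [h0] at h1
  exact zero_ne_one h1

end SkewEntries

/-! ## The laser restriction and the asymptotic-rank form -/

section Main

/-- **`T_skewcw,q^{⊗3m} ≥ ⟨p_m⟩ ⊗ ⟨q^m,q^m,q^m⟩`**, `q = 2u`, with
`288 C(2m,m) p_m ≥ C(3m,m) · rothNumberNat(3 C(2m,m))`: the skew little Coppersmith–Winograd tensor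
has signed Coppersmith–Winograd block structure (blocks `(0,1,1)`, `(1,0,1)` the identity, block
`(1,1,0)` the signed permutation matrix of the half-swap), so
`exists_restrictsTo_signedCw_kroneckerPow` applies ("`T_skewcw,q` has the same block structure
as `T_cw,q`", CGLV 2022 §2.2). [cite: ConnerGesmundoLandsbergVentura2022, §2.2] -/
theorem exists_restrictsTo_skewCw_kroneckerPow (u m : ℕ) (hm : 1 ≤ m) :
    ∃ p : ℕ, (3 * m).choose m * rothNumberNat (3 * (2 * m).choose m) ≤ 288 * (2 * m).choose m * p ∧
      TensorRestrictsTo (kroneckerPow (skewCwTensor ℂ u) (3 * m))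
        (kroneckerTensor (unitTensor ℂ p)
          (matMulTensor ℂ ((2 * u) ^ m) ((2 * u) ^ m) ((2 * u) ^ m))) := by
  -- the half-swap and its sign
  let σ : Fin (2 * u) → Fin (2 * u) := fun x =>
    ⟨if (x : ℕ) < u then (x : ℕ) + u else (x : ℕ) - u, by have := x.2; split_ifs <;> omega⟩
  have hσ : Function.Injective σ := by
    intro x y h
    have h' := congrArg Fin.val h
    simp only [σ] at h'
    apply Fin.ext
    have := x.2; have := y.2
    split_ifs at h' <;> omega
  refine exists_restrictsTo_signedCw_kroneckerPow (2 * u) m hm (skewCwTensor ℂ u) id id σ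
    (fun _ _ h => h) (fun _ _ h => h) hσ (fun _ => 1) (fun _ => 1)
    (fun x => if (x : ℕ) < u then 1 else -1) (fun _ => by simp) (fun _ => by simp)
    (fun x => by split_ifs <;> simp) ?_ ?_ ?_ ?_
  · intro x y; rw [skewCwTensor_zero_succ_succ]; rfl
  · intro x y; rw [skewCwTensor_succ_zero_succ]; rfl
  · intro x y
    rw [skewCwTensor_succ_succ_zero]
    have e : ((y : ℕ) = if (x : ℕ) < u then (x : ℕ) + u else (x : ℕ) - u) ↔ y = σ x := by
      simp only [σ, Fin.ext_iff]
    by_cases h : y = σ x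
    · rw [if_pos (e.2 h), if_pos h]
    · rw [if_neg (fun h' => h (e.1 h')), if_neg h]
  · intro i j k h
    exact skewCwTensor_ne_zero_pattern ℂ u h

/-- **CGLV 2022 §2.2 (arXiv Thm. 2.5), asymptotic-rank form — DISCHARGE of the named fact
`CGLV2022_skewCw_asymptoticRank_form`** (`SkewCoppersmithWinograd.lean`): for `q = 2u ≥ 2` and
`ρ > 0`, if `R(T_skewcw,q^{⊠N}) = O(ρ^{(1+ε)N})` for every `ε > 0` then `ω(ℂ) ≤ log_q(4ρ³/27)`.
"`T_skewcw,q` has the same block structure as `T_cw,q`, which immediately implies Theorem 1.1 also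
holds for `T_skewcw,q`": the abstract Coppersmith–Winograd bound
`omega_le_logb_of_laser_restrictions` with the restrictions
`exists_restrictsTo_skewCw_kroneckerPow`. [cite: ConnerGesmundoLandsbergVentura2022, §2.2 Thm. 2.5 (arXiv numbering)] -/
theorem CGLV2022_skewCw_asymptoticRank_form_holds : CGLV2022_skewCw_asymptoticRank_form := by
  intro u hu ρ hρ hyp
  have hq : 2 ≤ 2 * u := by omega
  have h := omega_le_logb_of_laser_restrictions (skewCwTensor ℂ u) (2 * u) hq ρ hρ
    (fun m hm => exists_restrictsTo_skewCw_kroneckerPow u m hm) hyp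
  have e : (((2 * u : ℕ) : ℝ)) = 2 * (u : ℝ) := by push_cast; ring
  rwa [e] at h

/-- From the discharged fact: **`R̃(T_skewcw,2) ≤ 3` (growth form) implies `ω(ℂ) ≤ 2`**
(CGLV 2022, p. 5: "`R̃(T_skewcw,2) = 3` would imply `ω = 2`"), now unconditional.
[cite: ConnerGesmundoLandsbergVentura2022, §2.2] -/
theorem omega_le_two_of_skewCw_one
    (hgrowth : ∀ ε : ℝ, 0 < ε →
      (fun N : ℕ => (tensorRank (K := ℂ) (kroneckerPow (skewCwTensor ℂ 1) N) : ℝ)) =O[atTop]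
        fun N : ℕ => (3 : ℝ) ^ ((1 + ε) * N)) :
    omega ℂ ≤ 2 :=
  logb_two_mul_one_skew CGLV2022_skewCw_asymptoticRank_form_holds hgrowth

end Main

/-! ## The rank form (corollary, by sub-multiplicativity of the rank) -/

section RankForm

variable {ι κ μ : Type} [Fintype ι] [Fintype κ] [Fintype μ]

/-- **Growth of the ranks of the Kronecker powers from one power** (any non-zero tensor `t` over
`ℂ`): with `r = R(t^{⊗k})`, `ρ = r^{1/k}` and `M = max(1, R(t^{⊗1}))`, `R(t^{⊗N}) ≤ M^k ρ^N` for all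
`N` (`N = k⌊N/k⌋ + (N mod k)`, sub-multiplicativity; CGLV p. 3: `R̃(T) ≤ R(T^{⊠k})^{1/k}`), as in
`tensorRank_kroneckerPow_cwTensor_le`. [cite: ConnerGesmundoLandsbergVentura2022, §1 (p. 3)] -/
theorem tensorRank_kroneckerPow_le_of_ne_zero (t : ι → κ → μ → ℂ) (ht : t ≠ 0) (k : ℕ) (hk : 1 ≤ k)
    (N : ℕ) :
    (tensorRank (kroneckerPow t N) : ℝ) ≤
      ((max 1 (tensorRank (kroneckerPow t 1)) : ℕ) : ℝ) ^ k *
        ((tensorRank (kroneckerPow t k) : ℝ) ^ ((k : ℝ)⁻¹)) ^ N := by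
  set r : ℕ := tensorRank (kroneckerPow t k) with hr
  set M : ℕ := max 1 (tensorRank (kroneckerPow t 1)) with hM
  have hr1 : 1 ≤ r := Literature.Barriers.MatrixMultiplication.one_le_tensorRank_of_ne_zero
    (Literature.Barriers.MatrixMultiplication.kroneckerPow_ne_zero ht k)
  have hr0 : (0 : ℝ) < r := by exact_mod_cast hr1
  have hr1' : (1 : ℝ) ≤ r := by exact_mod_cast hr1
  set ρ : ℝ := (r : ℝ) ^ ((k : ℝ)⁻¹) with hρ
  have hρ1 : 1 ≤ ρ := Real.one_le_rpow hr1' (inv_nonneg.2 (Nat.cast_nonneg _))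
  have hρk : ρ ^ k = (r : ℝ) := Real.rpow_inv_natCast_pow hr0.le (by omega)
  have hM1 : 1 ≤ M := le_max_left _ _
  have hN := Nat.div_add_mod N k
  have h1 : tensorRank (kroneckerPow t N) ≤ r ^ (N / k) * M ^ k := by
    have h := tensorRank_kroneckerPow_add_le t (k * (N / k)) (N % k)
    rw [hN] at h
    refine h.trans (Nat.mul_le_mul (tensorRank_kroneckerPow_mul_le_pow t k (N / k)) ?_)
    calc tensorRank (kroneckerPow t (N % k)) = tensorRank (kroneckerPow t (1 * (N % k))) := by
          rw [one_mul]
      _ ≤ tensorRank (kroneckerPow t 1) ^ (N % k) := tensorRank_kroneckerPow_mul_le_pow t 1 _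
      _ ≤ M ^ (N % k) := Nat.pow_le_pow_left (le_max_right _ _) _
      _ ≤ M ^ k := Nat.pow_le_pow_right hM1 (Nat.mod_lt N (by omega)).le
  have h2 : (r : ℝ) ^ (N / k) ≤ ρ ^ N := by
    rw [← hρk, ← pow_mul]
    exact pow_le_pow_right₀ hρ1 (Nat.mul_div_le N k)
  calc (tensorRank (kroneckerPow t N) : ℝ) ≤ ((r ^ (N / k) * M ^ k : ℕ) : ℝ) := by exact_mod_cast h1
    _ = (r : ℝ) ^ (N / k) * (M : ℝ) ^ k := by push_cast; ring
    _ ≤ ρ ^ N * (M : ℝ) ^ k := mul_le_mul_of_nonneg_right h2 (by positivity)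
    _ = (M : ℝ) ^ k * ρ ^ N := mul_comm _ _

/-- **CGLV 2022 §2.2 (arXiv Thm. 2.5), rank form — DISCHARGE of the named fact
`CGLV2022_skewCw_rank_form`**: for `q = 2u ≥ 2` and `k ≥ 1`,
`ω(ℂ) ≤ log_q((4/27) · R(T_skewcw,q^{⊠k})^{3/k})`. With `r = R(T_skewcw,q^{⊠k}) ≥ 1` and
`ρ = r^{1/k}`, sub-multiplicativity of the rank gives `R(T^{⊗N}) ≤ M^k ρ^N ≤ M^k ρ^{(1+ε)N}`
(`tensorRank_kroneckerPow_le_of_ne_zero`), the hypothesis of the asymptotic-rank form, whose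
conclusion `ω ≤ log_q(4ρ³/27)` is the claim (`ρ³ = r^{3/k}`) — exactly as
`CoppersmithWinograd1990_rank_form_holds`. [cite: ConnerGesmundoLandsbergVentura2022, §2.2 Thm. 2.5 (arXiv numbering), with bR ≤ R] -/
theorem CGLV2022_skewCw_rank_form_holds : CGLV2022_skewCw_rank_form := by
  intro u k hu hk
  set T := skewCwTensor ℂ u with hT
  have hT0 : T ≠ 0 := skewCwTensor_ne_zero ℂ u hu
  set r : ℕ := tensorRank (kroneckerPow T k) with hr
  have hr1 : 1 ≤ r := Literature.Barriers.MatrixMultiplication.one_le_tensorRank_of_ne_zero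
    (Literature.Barriers.MatrixMultiplication.kroneckerPow_ne_zero hT0 k)
  have hr0 : (0 : ℝ) < r := by exact_mod_cast hr1
  have hr1' : (1 : ℝ) ≤ r := by exact_mod_cast hr1
  set ρ : ℝ := (r : ℝ) ^ ((k : ℝ)⁻¹) with hρ
  have hρ1 : 1 ≤ ρ := Real.one_le_rpow hr1' (inv_nonneg.2 (Nat.cast_nonneg _))
  have hρ0 : 0 < ρ := by linarith
  set M : ℕ := max 1 (tensorRank (kroneckerPow T 1)) with hM
  -- the hypothesis of the asymptotic-rank form
  have hyp : ∀ ε : ℝ, 0 < ε →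
      (fun N : ℕ => (tensorRank (kroneckerPow T N) : ℝ)) =O[atTop]
        fun N : ℕ => ρ ^ ((1 + ε) * N) := by
    intro ε hε
    refine Asymptotics.IsBigO.of_bound ((M : ℝ) ^ k) (Filter.Eventually.of_forall fun N => ?_)
    rw [Real.norm_of_nonneg (Nat.cast_nonneg _),
      Real.norm_of_nonneg (Real.rpow_pos_of_pos hρ0 _).le]
    calc (tensorRank (kroneckerPow T N) : ℝ) ≤ (M : ℝ) ^ k * ρ ^ N :=
          tensorRank_kroneckerPow_le_of_ne_zero T hT0 k hk N
      _ ≤ (M : ℝ) ^ k * ρ ^ ((1 + ε) * N) := by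
          refine mul_le_mul_of_nonneg_left ?_ (by positivity)
          calc ρ ^ N = ρ ^ (N : ℝ) := (Real.rpow_natCast ρ N).symm
            _ ≤ ρ ^ ((1 + ε) * N) := Real.rpow_le_rpow_of_exponent_le hρ1
                (le_mul_of_one_le_left (Nat.cast_nonneg N) (by linarith))
  have h := CGLV2022_skewCw_asymptoticRank_form_holds u hu ρ hρ0 hyp
  have hρ3 : ρ ^ 3 = (r : ℝ) ^ ((3 : ℝ) / k) := by
    rw [hρ, ← Real.rpow_natCast, ← Real.rpow_mul hr0.le]
    congr 1
    push_cast
    ring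
  have e : 4 * ρ ^ 3 / 27 = 4 / 27 * (r : ℝ) ^ ((3 : ℝ) / k) := by rw [hρ3]; ring
  rwa [e] at h

end RankForm

end Literature.Computability.AlgebraicComplexity

end
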